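import Literature.MathematicalPhysics.QuantumLattice.StructureFactorSumRuleFloor
import HarnessLib

/-!
# The pair structure factor of a density matrix: sum rules and `k = 0` floors in the certificate
# vocabulary

Topic `MathematicalPhysics/QuantumLattice` (family `hubbard`; cell `hubbard-cq`). Density-matrix twin of the
pair-field part of `StructureFactorSumRuleFloor.lean`. There the pair structure factor is the tree's
`pairStructureFactor g L ψ m = L⁻²‖Δ_g(m)ψ‖²` of a Fock VECTOR `ψ`; ground-state certificates of the summit
`HubbardSuperconductivity` quantify over DENSITY MATRICES `ρ` (every ground-state density matrix,
`IsGroundStateDensityMatrix`; reduced-density-matrix rows are linear functionals `Re tr(ρ ·)`). This file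
restates the sum rules and floors for `S_ρ(m) := L⁻² Re tr(ρ Δ_g(m)ᴴ Δ_g(m))` (written out; no definition is
introduced), so that certified two-sided windows on `Re tr(ρ Σ_x P_xᴴ P_{x+z})` — site-summed pair
correlations at shift `z`, 2-RDM functionals — plug in literally:

* `sum_trace_mul_conjTranspose_pairFieldAt_mul` — operator Plancherel traced against any matrix `ρ`:
  `Σ_m tr(ρ Δ_g(m)ᴴΔ_g(m)) = L² tr(ρ Σ_x P_xᴴP_x)`; shifted form
  `sum_torusChar_mul_trace_mul_conjTranspose_pairFieldAt_mul`: `Σ_m χ_m(z) tr(ρ Δ_g(m)ᴴΔ_g(m)) = L² tr(ρ Σ_x P_xᴴP_{x+z})`.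
* `trace_mul_conjTranspose_mul_self_im_eq_zero` / `re_trace_mul_conjTranspose_mul_self_nonneg` — for
  `ρ ⪰ 0`, `tr(ρ AᴴA)` is real and nonnegative; hence the real dictionary sum rule
  `sum_re_torusChar_mul_re_trace_pairFieldAt` : `Σ_m Re χ_m(z) · L⁻² Re tr(ρΔ_g(m)ᴴΔ_g(m)) = Re tr(ρ Σ_x P_xᴴP_{x+z})`.
* Floors on the zero mode `L⁻² Re tr(ρ Δ_gᴴ Δ_g)`: `re_trace_pairField_ge_of_onSite_floor_of_ceilings` (plain:
  on-site floor `cL² ≤ Re tr(ρ Σ_x P_xᴴP_x)` + ceilings `B_m`, `m ≠ 0`; ANY matrix `ρ`),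
  `re_trace_pairField_div_ge_of_onSite_floor_of_ceilings` (normalisation `L⁻⁴`), and the LP-dual window form
  `kernel_re_trace_pairField_floor` (`ρ ⪰ 0`; rows `|Re tr(ρ Σ_x P_xᴴP_{x+z}) - c_z| ≤ ε_z` on a finite window
  `W`, any weights `κ`): `Σ_{z∈W}(κ_z c_z - |κ_z| ε_z) - Σ_{m≠0} K(m)⁺ B_m ≤ K(0) · L⁻² Re tr(ρ Δ_gᴴΔ_g)`.
* `re_trace_pairField_ge_of_onSite_floor_of_sectorGaps` — composition with the spectral mode ceiling of
  `GroundStateSectorGapModeBound.lean` for a GLOBAL ground-supported `ρ` (`Hρ = E₀(H)ρ`, e.g. the grand-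
  canonical Fock-space ground state of `H - μN`): sector gaps `ω_m` and double-commutator ceilings `D_m` at
  `m ≠ 0` plus the on-site floor give `cL⁴ - Σ_{m≠0} D_m/ω_m ≤ Re tr(ρ Δ_gᴴΔ_g)`. (The fixed-particle-number
  SECTOR version, with eigenvalue `E ≠ E₀(H)`, is the sibling `PairStructureFactorSectorGapCeiling.lean`.)

HONEST FRAMING (cell hubbard-cq census (10), critic-2 K1′): plumbing for finite-range / LP certificate
shapes; CONDITIONAL as an instrument — the `m ≠ 0` ceilings are inputs asserted for no model, and at the
cuprate anchors `(8, 7/8, 0 or -1/4)` the closure is dead on magnitude (condensate share `≤ 3.7 %`) even with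
exact inputs. No definition and no named fact is introduced.

## References
* T. Kennedy, E. H. Lieb, B. S. Shastry, Phys. Rev. Lett. 61 (1988) 2582–2584 [KLS1988PRL], pp. 2582–2583.
* T. Kennedy, E. H. Lieb, B. S. Shastry, J. Stat. Phys. 53 (1988) 1019–1030 [KLS1988JSP], eqs. (2)–(3),
  (6)–(9).
* M. G. Scheer, N. Chadha, D.-C. Lu, E. Khalaf, arXiv:2511.20860 (2025), p. 3 eqs. (2)–(3) [ScheerEtAl2025]
  (certificates quantified over ground-state density operators).
* D. J. Scalapino, Phys. Rep. 250 (1995) 329, §2 [Scalapino1995].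
-/

noncomputable section

open Matrix Finset
open scoped ComplexOrder ComplexConjugate
open Literature.Probability.LatticeModels

namespace Literature.MathematicalPhysics.QuantumLattice

open HubbardWave0

/-! ### Traces of `ρ AᴴA` -/

section Trace

variable {n : Type*} [Fintype n] [DecidableEq n]

omit [DecidableEq n] in
/-- For `ρ ⪰ 0` and any `A`, `tr(ρ AᴴA) = tr(A ρ Aᴴ)` has zero imaginary part. [folklore]
[cite: ScheerEtAl2025, p. 3 eqs. (2)-(3)] -/
theorem trace_mul_conjTranspose_mul_self_im_eq_zero {ρ : Matrix n n ℂ} (hρ : ρ.PosSemidef)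
    (A : Matrix n n ℂ) : (ρ * (Aᴴ * A)).trace.im = 0 := by
  have h : (ρ * (Aᴴ * A)).trace = (A * ρ * Aᴴ).trace := by
    rw [← Matrix.mul_assoc, Matrix.trace_mul_cycle]
  rw [h]
  exact ((Complex.nonneg_iff.1 (hρ.mul_mul_conjTranspose_same A).trace_nonneg).2).symm

/-- For `ρ ⪰ 0` and any `A`, `0 ≤ Re tr(ρ AᴴA)`. [folklore] [cite: ScheerEtAl2025, p. 3 eqs. (2)-(3)] -/
theorem re_trace_mul_conjTranspose_mul_self_nonneg {ρ : Matrix n n ℂ} (hρ : ρ.PosSemidef)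
    (A : Matrix n n ℂ) : 0 ≤ (ρ * (Aᴴ * A)).trace.re :=
  Literature.LinearAlgebra.Matrix.re_trace_mul_nonneg_of_posSemidef hρ
    (posSemidef_conjTranspose_mul_self A)

end Trace

section PairField

variable (g : Site 2 → ℝ) (L : ℕ) [NeZero L]

/-! ### Sum rules traced against a density matrix -/

/-- **Pair sum rule, density-matrix form**: `Σ_m tr(ρ Δ_g(m)ᴴ Δ_g(m)) = L² tr(ρ Σ_x P_xᴴ P_x)` for ANY
matrix `ρ` (operator Plancherel `sum_conjTranspose_pairFieldAt_mul_self` traced against `ρ`).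
[cite: KLS1988PRL, p. 2582] -/
theorem sum_trace_mul_conjTranspose_pairFieldAt_mul
    (ρ : Matrix (Finset (Orb (FermionTorus 2 L))) (Finset (Orb (FermionTorus 2 L))) ℂ) :
    ∑ m, (ρ * ((pairFieldAt g L m)ᴴ * pairFieldAt g L m)).trace =
      (L : ℂ) ^ 2 * (ρ * ∑ x, (localPair g L x)ᴴ * localPair g L x).trace := by
  rw [← Matrix.trace_sum, ← Finset.mul_sum, sum_conjTranspose_pairFieldAt_mul_self, Matrix.mul_smul,
    Matrix.trace_smul, smul_eq_mul]

/-- **Shifted pair sum rule, density-matrix form**: for every shift `z`,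
`Σ_m χ_m(z) tr(ρ Δ_g(m)ᴴ Δ_g(m)) = L² tr(ρ Σ_x P_xᴴ P_{x+z})` for ANY matrix `ρ`
(`sum_torusChar_smul_conjTranspose_pairFieldAt_mul` traced against `ρ`). [cite: KLS1988JSP, eqs. (2)-(3)] -/
theorem sum_torusChar_mul_trace_mul_conjTranspose_pairFieldAt_mul
    (ρ : Matrix (Finset (Orb (FermionTorus 2 L))) (Finset (Orb (FermionTorus 2 L))) ℂ)
    (z : TorusSite 2 L) :
    ∑ m, torusChar m z * (ρ * ((pairFieldAt g L m)ᴴ * pairFieldAt g L m)).trace =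
      (L : ℂ) ^ 2 * (ρ * ∑ x, (localPair g L x)ᴴ * localPair g L (x + z)).trace := by
  have h := congrArg (fun T => (ρ * T).trace) (sum_torusChar_smul_conjTranspose_pairFieldAt_mul g L z)
  simpa only [Finset.mul_sum, Matrix.mul_smul, Matrix.trace_sum, Matrix.trace_smul, smul_eq_mul] using h

/-- **Pair sum rule for the normalised structure factor of a density matrix** (real parts; any `ρ`):
`Σ_m L⁻² Re tr(ρ Δ_g(m)ᴴ Δ_g(m)) = Re tr(ρ Σ_x P_xᴴ P_x)`. [cite: KLS1988PRL, p. 2582] -/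
theorem sum_re_trace_pairFieldAt_div
    (ρ : Matrix (Finset (Orb (FermionTorus 2 L))) (Finset (Orb (FermionTorus 2 L))) ℂ) :
    ∑ m, (ρ * ((pairFieldAt g L m)ᴴ * pairFieldAt g L m)).trace.re / (L : ℝ) ^ 2 =
      (ρ * ∑ x, (localPair g L x)ᴴ * localPair g L x).trace.re := by
  have hL : (L : ℝ) ^ 2 ≠ 0 := pow_ne_zero _ (Nat.cast_ne_zero.2 (NeZero.ne L))
  rw [← Finset.sum_div, ← Complex.re_sum, sum_trace_mul_conjTranspose_pairFieldAt_mul,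
    show ((L : ℂ) ^ 2) = (((L : ℝ) ^ 2 : ℝ) : ℂ) by push_cast; rfl, Complex.re_ofReal_mul,
    mul_div_cancel_left₀ _ hL]

/-- **Dictionary sum rule for the normalised structure factor of a state** (`ρ ⪰ 0`, so that each
`tr(ρ Δ_g(m)ᴴΔ_g(m))` is real): `Σ_m Re χ_m(z) · L⁻² Re tr(ρ Δ_g(m)ᴴ Δ_g(m)) = Re tr(ρ Σ_x P_xᴴ P_{x+z})` — the
row functional is the site-summed pair correlation at shift `z`, a reduced-density-matrix quantity.
[cite: KLS1988JSP, eqs. (2)-(3)] -/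
theorem sum_re_torusChar_mul_re_trace_pairFieldAt
    {ρ : Matrix (Finset (Orb (FermionTorus 2 L))) (Finset (Orb (FermionTorus 2 L))) ℂ} (hρ : ρ.PosSemidef)
    (z : TorusSite 2 L) :
    ∑ m, (torusChar m z).re * ((ρ * ((pairFieldAt g L m)ᴴ * pairFieldAt g L m)).trace.re / (L : ℝ) ^ 2) =
      (ρ * ∑ x, (localPair g L x)ᴴ * localPair g L (x + z)).trace.re := by
  have hL : (L : ℝ) ^ 2 ≠ 0 := pow_ne_zero _ (Nat.cast_ne_zero.2 (NeZero.ne L))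
  have hterm : ∀ m : TorusSite 2 L,
      (torusChar m z).re * ((ρ * ((pairFieldAt g L m)ᴴ * pairFieldAt g L m)).trace.re / (L : ℝ) ^ 2) =
        (torusChar m z * (ρ * ((pairFieldAt g L m)ᴴ * pairFieldAt g L m)).trace).re / (L : ℝ) ^ 2 := by
    intro m
    rw [Complex.mul_re, trace_mul_conjTranspose_mul_self_im_eq_zero hρ, mul_zero, sub_zero, mul_div_assoc]
  simp_rw [hterm]
  rw [← Finset.sum_div, ← Complex.re_sum, sum_torusChar_mul_trace_mul_conjTranspose_pairFieldAt_mul,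
    show ((L : ℂ) ^ 2) = (((L : ℝ) ^ 2 : ℝ) : ℂ) by push_cast; rfl, Complex.re_ofReal_mul,
    mul_div_cancel_left₀ _ hL]

/-! ### Floors on the zero mode -/

/-- **Plain floor, density-matrix form** (ANY matrix `ρ`): an on-site floor `cL² ≤ Re tr(ρ Σ_x P_xᴴP_x)` and
ceilings `L⁻² Re tr(ρ Δ_g(m)ᴴΔ_g(m)) ≤ B_m` at every `m ≠ 0` give
`cL² - Σ_{m≠0} B_m ≤ L⁻² Re tr(ρ Δ_gᴴ Δ_g)` (`Δ_g = pairField g L = Δ_g(0)`). CONDITIONAL as an instrument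
(the `B_m` are inputs). [cite: KLS1988PRL, p. 2583] -/
theorem re_trace_pairField_ge_of_onSite_floor_of_ceilings
    (ρ : Matrix (Finset (Orb (FermionTorus 2 L))) (Finset (Orb (FermionTorus 2 L))) ℂ) {c : ℝ}
    (B : TorusSite 2 L → ℝ)
    (hfloor : c * (L : ℝ) ^ 2 ≤ (ρ * ∑ x, (localPair g L x)ᴴ * localPair g L x).trace.re)
    (hceil : ∀ m : TorusSite 2 L, m ≠ 0 →
      (ρ * ((pairFieldAt g L m)ᴴ * pairFieldAt g L m)).trace.re / (L : ℝ) ^ 2 ≤ B m) :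
    c * (L : ℝ) ^ 2 - ∑ m ∈ (univ : Finset (TorusSite 2 L)).erase 0, B m ≤
      (ρ * ((pairField g L)ᴴ * pairField g L)).trace.re / (L : ℝ) ^ 2 := by
  have h := sub_sum_erase_le_of_sumRule_of_ceilings
    (fun m => (ρ * ((pairFieldAt g L m)ᴴ * pairFieldAt g L m)).trace.re / (L : ℝ) ^ 2) B 0
    (hfloor.trans (sum_re_trace_pairFieldAt_div g L ρ).symm.le) hceil
  simpa only [pairFieldAt_zero] using h

/-- **Plain floor in the long-range-order normalisation** `L⁻⁴ Re tr(ρ Δ_gᴴ Δ_g)`: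
`c - L⁻² Σ_{m≠0} B_m ≤ L⁻⁴ Re tr(ρ Δ_gᴴ Δ_g)`. [cite: KLS1988PRL, p. 2583] [cite: Scalapino1995, §2] -/
theorem re_trace_pairField_div_ge_of_onSite_floor_of_ceilings
    (ρ : Matrix (Finset (Orb (FermionTorus 2 L))) (Finset (Orb (FermionTorus 2 L))) ℂ) {c : ℝ}
    (B : TorusSite 2 L → ℝ)
    (hfloor : c * (L : ℝ) ^ 2 ≤ (ρ * ∑ x, (localPair g L x)ᴴ * localPair g L x).trace.re)
    (hceil : ∀ m : TorusSite 2 L, m ≠ 0 →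
      (ρ * ((pairFieldAt g L m)ᴴ * pairFieldAt g L m)).trace.re / (L : ℝ) ^ 2 ≤ B m) :
    c - (∑ m ∈ (univ : Finset (TorusSite 2 L)).erase 0, B m) / (L : ℝ) ^ 2 ≤
      (ρ * ((pairField g L)ᴴ * pairField g L)).trace.re / (L : ℝ) ^ 4 := by
  have hL : (0 : ℝ) < (L : ℝ) ^ 2 := pow_pos (Nat.cast_pos.2 (Nat.pos_of_ne_zero (NeZero.ne L))) 2
  have h2 := div_le_div_of_nonneg_right
    (re_trace_pairField_ge_of_onSite_floor_of_ceilings g L ρ B hfloor hceil) hL.le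
  rw [sub_div, mul_div_cancel_right₀ _ hL.ne', div_div,
    show (L : ℝ) ^ 2 * (L : ℝ) ^ 2 = (L : ℝ) ^ 4 by ring] at h2
  exact h2

/-- **LP-dual floor with a certified window of 2-RDM pair correlations, density-matrix form.** For a state
`ρ ⪰ 0`: certified two-sided rows `|Re tr(ρ Σ_x P_xᴴ P_{x+z}) - c_z| ≤ ε_z` on a finite window `W` of shifts,
ceilings `L⁻² Re tr(ρ Δ_g(m)ᴴΔ_g(m)) ≤ B_m` (`m ≠ 0`), and ANY real weights `κ_z` (the LP dual certificate) give,
with `K(m) = Σ_{z∈W} κ_z Re χ_m(z)`,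
`Σ_{z∈W}(κ_z c_z - |κ_z| ε_z) - Σ_{m≠0} K(m)⁺ B_m ≤ K(0) · L⁻² Re tr(ρ Δ_gᴴ Δ_g)`.
CONDITIONAL as an instrument (the `B_m` are inputs). [cite: KLS1988JSP, eqs. (2)-(3), (6)-(9)] -/
theorem kernel_re_trace_pairField_floor
    {ρ : Matrix (Finset (Orb (FermionTorus 2 L))) (Finset (Orb (FermionTorus 2 L))) ℂ} (hρ : ρ.PosSemidef)
    (W : Finset (TorusSite 2 L)) (κ c ε : TorusSite 2 L → ℝ) (B : TorusSite 2 L → ℝ)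
    (hrow : ∀ z ∈ W,
      |(ρ * ∑ x, (localPair g L x)ᴴ * localPair g L (x + z)).trace.re - c z| ≤ ε z)
    (hceil : ∀ m : TorusSite 2 L, m ≠ 0 →
      (ρ * ((pairFieldAt g L m)ᴴ * pairFieldAt g L m)).trace.re / (L : ℝ) ^ 2 ≤ B m) :
    ∑ z ∈ W, (κ z * c z - |κ z| * ε z) -
        ∑ m ∈ (univ : Finset (TorusSite 2 L)).erase 0,
          max (∑ z ∈ W, κ z * (torusChar m z).re) 0 * B m ≤
      (∑ z ∈ W, κ z) *
        ((ρ * ((pairField g L)ᴴ * pairField g L)).trace.re / (L : ℝ) ^ 2) := by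
  have h := lpDual_kernel_floor W (fun z m => (torusChar m z).re) c ε κ
    (fun m => (ρ * ((pairFieldAt g L m)ᴴ * pairFieldAt g L m)).trace.re / (L : ℝ) ^ 2) B 0
    (fun m => div_nonneg (re_trace_mul_conjTranspose_mul_self_nonneg hρ _) (sq_nonneg _))
    (fun z hz => by rw [sum_re_torusChar_mul_re_trace_pairFieldAt g L hρ]; exact hrow z hz) hceil
  simpa only [torusChar_zero_left, Complex.one_re, mul_one, pairFieldAt_zero] using h

/-! ### Composition with the spectral mode ceiling (global ground state) -/

/-- **On-site floor + sector gaps off `m = 0` ⇒ pair long-range-order floor, every GLOBAL ground-supported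
state.** For a Hermitian `H` on the Fock space of the torus, `ρ ⪰ 0` with `Hρ = E₀(H)ρ`, an on-site floor
`cL² ≤ Re tr(ρ Σ_x P_xᴴ P_x)`, and at every `m ≠ 0`: range conditions `P_m(Δ_g(m)ρ) = Δ_g(m)ρ`,
`P'_m(Δ_g(m)ᴴρ) = Δ_g(m)ᴴρ`, sector gaps `P_mᴴ(H - E₀ - ω_m)P_m ⪰ 0`, `P'_mᴴ(H - E₀ - ω_m)P'_m ⪰ 0` with
`ω_m > 0`, and double-commutator ceilings `Re tr(ρ[Δ_g(m)ᴴ,[H,Δ_g(m)]]) ≤ D_m`: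
`cL⁴ - Σ_{m≠0} D_m/ω_m ≤ Re tr(ρ Δ_gᴴ Δ_g)` (`trace_conjTranspose_mul_ge_of_sumRule_of_sectorGaps` on the pair
modes). CONDITIONAL as an instrument: the gaps `ω_m` are inputs (card `yrast-landau-ir-step`), asserted for
no model; fixed-`N` sector ground states need the sector sibling instead. [cite: KLS1988PRL, p. 2583]
[cite: Feynman1954, §III] -/
theorem re_trace_pairField_ge_of_onSite_floor_of_sectorGaps
    {H ρ : Matrix (Finset (Orb (FermionTorus 2 L))) (Finset (Orb (FermionTorus 2 L))) ℂ}
    (hH : H.IsHermitian) (hρ : ρ.PosSemidef) (hHρ : H * ρ = (H.groundEnergy : ℂ) • ρ) {c : ℝ}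
    (P P' : TorusSite 2 L → Matrix (Finset (Orb (FermionTorus 2 L))) (Finset (Orb (FermionTorus 2 L))) ℂ)
    (ω D : TorusSite 2 L → ℝ)
    (hfloor : c * (L : ℝ) ^ 2 ≤ (ρ * ∑ x, (localPair g L x)ᴴ * localPair g L x).trace.re)
    (hPA : ∀ m : TorusSite 2 L, m ≠ 0 → P m * (pairFieldAt g L m * ρ) = pairFieldAt g L m * ρ)
    (hP'A : ∀ m : TorusSite 2 L, m ≠ 0 →
      P' m * ((pairFieldAt g L m)ᴴ * ρ) = (pairFieldAt g L m)ᴴ * ρ)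
    (hω : ∀ m : TorusSite 2 L, m ≠ 0 → 0 < ω m)
    (hgap : ∀ m : TorusSite 2 L, m ≠ 0 →
      ((P m)ᴴ * (H - ((H.groundEnergy + ω m : ℝ) : ℂ) • 1) * P m).PosSemidef)
    (hgap' : ∀ m : TorusSite 2 L, m ≠ 0 →
      ((P' m)ᴴ * (H - ((H.groundEnergy + ω m : ℝ) : ℂ) • 1) * P' m).PosSemidef)
    (hD : ∀ m : TorusSite 2 L, m ≠ 0 →
      (ρ * ((pairFieldAt g L m)ᴴ * (H * pairFieldAt g L m - pairFieldAt g L m * H) -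
        (H * pairFieldAt g L m - pairFieldAt g L m * H) * (pairFieldAt g L m)ᴴ)).trace.re ≤ D m) :
    c * (L : ℝ) ^ 4 - ∑ m ∈ (univ : Finset (TorusSite 2 L)).erase 0, D m / ω m ≤
      (ρ * ((pairField g L)ᴴ * pairField g L)).trace.re := by
  have hL : (0 : ℝ) < (L : ℝ) ^ 2 := pow_pos (Nat.cast_pos.2 (Nat.pos_of_ne_zero (NeZero.ne L))) 2
  have hsum : c * (L : ℝ) ^ 4 ≤ ∑ m, (ρ * ((pairFieldAt g L m)ᴴ * pairFieldAt g L m)).trace.re := by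
    have h1 := sum_re_trace_pairFieldAt_div g L ρ
    rw [← Finset.sum_div, div_eq_iff hL.ne'] at h1
    rw [h1, show c * (L : ℝ) ^ 4 = c * (L : ℝ) ^ 2 * (L : ℝ) ^ 2 by ring]
    exact mul_le_mul_of_nonneg_right hfloor hL.le
  have h := trace_conjTranspose_mul_ge_of_sumRule_of_sectorGaps hH hρ hHρ (pairFieldAt g L) P P' ω D 0
    hsum hPA hP'A hω hgap hgap' hD
  simpa only [pairFieldAt_zero] using h

end PairField

end Literature.MathematicalPhysics.QuantumLattice
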